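import Literature.Computability.AlgebraicComplexity.CwSquareKoszulKronecker
import HarnessLib

/-!
# Block-diagonalising the slice matrices of `T_{cw,q}`: the dual bases `(γ_k)`, `(f_l)`

Topic `Literature/Computability/AlgebraicComplexity`.  Second step of the proof of
`CGLV2022_thm33_koszulRank` (CGLV 2022, Thm. 3.3; the elementary core of the "second proof",
§3.5: the `𝔖_{q-3}`-isotypic decomposition of `V = K^{q+1}`, done here with explicit matrices and
no representation theory).  On `V` with basis `u_0, …, u_q` put

* columns `f_l` (the matrix `U`): `f_l = u_l` (`l ≤ 3`), `f_4 = w' = ∑_{a ≥ 4} u_a`,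
  `f_l = u_l - u_4` (`l ≥ 5`; a basis of the "standard" part `{x : x_0 = ⋯ = x_3 = 0, ∑ x_a = 0}`);
* rows `γ_k` (the matrix `U'`): `γ_k = u_k^*` (`k ≤ 3`), `γ_4 = ∑_{a ≥ 4} u_a^*`,
  `γ_k = (q-3) u_k^* - ∑_{a ≥ 4} u_a^*` (`k ≥ 5`),

so that `U' U = diag(1,1,1,1,t,…,t)`, `t = q - 3`.  For each slice matrix `G ∈ {D, G_1, G_2, G_3, S}`
of `CwSquareKoszulKronecker.lean` the matrix `U' G U` is block diagonal — a `5 × 5` block on the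
indices `≤ 4` with entries in `{0, 1, t}` and the scalar `t` (for `D`, `S`) or `0` (for `G_a`) on the
indices `≥ 5`:

  `U' D U = diag(0,1,1,1,t) ⊕ t·1`,  `U' G_a U = G_a` (`a = 1,2,3`),
  `U' S U = [[0,1,1,1,t],[1,1,0,0,0],[1,0,1,0,0],[1,0,0,1,0],[t,0,0,0,t]] ⊕ t·1`

(`conj_opD`, `conj_opG`, `conj_opS`, with the closed forms `bD`, `opG`, `bS`).  Consequently
(`sandwich_Kx`) `(1 ⊗ U' ⊗ U') K_x (1 ⊗ U ⊗ U) = K̃ := ∑_j Inc_j ⊗ Ψ_j` with `Ψ_j` the same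
Kronecker expressions in `D̃ = U'DU`, `G_a`, `S̃ = U'SU`; since `rank (P K Q) ≤ rank K` this explicit
block-diagonal matrix bounds `rank K_q` from below (the entries of `K̃` and the certificates are
in `CwSquareKoszulCert.lean`, the assembly in `BorderRankCWKoszulRanksProofs.lean`).  No
invertibility of `U` is needed or proved.  Everything here is PROVED; `q ≥ 4` throughout.

## References

* A. Conner, F. Gesmundo, J. M. Landsberg, E. Ventura, comput. complexity 31 (2022) =
  arXiv:1909.04785, §3.5 (second proof of Thm. 3.3: the decomposition
  `B = C = [triv]^{⊕5} ⊕ V`). [ConnerGesmundoLandsbergVentura2022]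
-/

noncomputable section

open scoped BigOperators
open Matrix

namespace Literature.Computability.AlgebraicComplexity

namespace CGLVThm33

variable (R : Type*) [CommRing R] (q : ℕ)

/-! ## The vectors `e_m`, `w'` and the matrices `U`, `U'` -/

/-- The coordinate vector `u_m` (zero if `m > q`). [folklore] -/
def eV (m : ℕ) : Fin (q + 1) → R := fun i => if (i : ℕ) = m then 1 else 0

/-- The vector `w' = ∑_{a ≥ 4} u_a` spanning the trivial `𝔖_{q-3}`-type inside `⟨u_4, …, u_q⟩`.
[cite: ConnerGesmundoLandsbergVentura2022, §3.5] -/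
def wV : Fin (q + 1) → R := fun i => if 4 ≤ (i : ℕ) then 1 else 0

/-- The parameter `t = q - 3`. [cite: ConnerGesmundoLandsbergVentura2022, §3.5] -/
def tq : R := (q : R) - 3

/-- The column basis `f_l`: `u_l` (`l ≤ 3`), `w'` (`l = 4`), `u_l - u_4` (`l ≥ 5`); `U i l` is the
`i`-th coordinate of `f_l`. [cite: ConnerGesmundoLandsbergVentura2022, §3.5] -/
def U : Matrix (Fin (q + 1)) (Fin (q + 1)) R := fun i l =>
  if (l : ℕ) ≤ 3 then eV R q l i else if (l : ℕ) = 4 then wV R q i else eV R q l i - eV R q 4 i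

/-- The row functionals `γ_k`: `u_k^*` (`k ≤ 3`), `∑_{a≥4} u_a^*` (`k = 4`),
`(q-3) u_k^* - ∑_{a≥4} u_a^*` (`k ≥ 5`); `U' k i = γ_k(u_i)`. [cite: ConnerGesmundoLandsbergVentura2022, §3.5] -/
def U' : Matrix (Fin (q + 1)) (Fin (q + 1)) R := fun k i =>
  if (k : ℕ) ≤ 3 then eV R q k i else if (k : ℕ) = 4 then wV R q i else tq R q * eV R q k i - wV R q i

/-- Closed form of `U' D U`: `diag(0, 1, 1, 1, t, t, …, t)`. [cite: ConnerGesmundoLandsbergVentura2022, §3.5] -/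
def bD : Matrix (Fin (q + 1)) (Fin (q + 1)) R := fun k l =>
  if (k : ℕ) = l then (if (k : ℕ) = 0 then 0 else if (k : ℕ) ≤ 3 then 1 else tq R q) else 0

/-- Closed form of `U' S U`: the `5 × 5` block `[[0,1,1,1,t],[1,1,0,0,0],[1,0,1,0,0],[1,0,0,1,0],
[t,0,0,0,t]]` on indices `≤ 4` and `t` times the identity on indices `≥ 5`.
[cite: ConnerGesmundoLandsbergVentura2022, §3.5] -/
def bS : Matrix (Fin (q + 1)) (Fin (q + 1)) R := fun k l =>
  if (k : ℕ) = 0 then (if 1 ≤ (l : ℕ) ∧ (l : ℕ) ≤ 3 then 1 else if (l : ℕ) = 4 then tq R q else 0)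
  else if (k : ℕ) ≤ 3 then (if (l : ℕ) = 0 ∨ (l : ℕ) = k then 1 else 0)
  else if (k : ℕ) = 4 then (if (l : ℕ) = 0 ∨ (l : ℕ) = 4 then tq R q else 0)
  else (if (l : ℕ) = k then tq R q else 0)

variable {R q}

/-! ## Sums over `Fin (q+1)` -/

/-- `∑_i [i = m] g i = g m` for `m ≤ q`. [folklore] -/
theorem sum_ite_val_eq {m : ℕ} (hm : m < q + 1) (g : Fin (q + 1) → R) :
    ∑ i : Fin (q + 1), (if (i : ℕ) = m then g i else 0) = g ⟨m, hm⟩ := by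
  rw [Finset.sum_eq_single (⟨m, hm⟩ : Fin (q + 1))]
  · simp
  · intro i _ hi
    rw [if_neg]
    intro h
    exact hi (Fin.ext h)
  · intro h; exact absurd (Finset.mem_univ _) h

/-- `∑_i [i = m] g i = 0` for `m > q`. [folklore] -/
theorem sum_ite_val_eq_of_lt {m : ℕ} (hm : q + 1 ≤ m) (g : Fin (q + 1) → R) :
    ∑ i : Fin (q + 1), (if (i : ℕ) = m then g i else 0) = 0 := by
  refine Finset.sum_eq_zero fun i _ => ?_
  rw [if_neg]
  intro h
  have := i.2
  omega

/-- `∑_i [4 ≤ i] = q - 3` (as `t = q - 3 ∈ R`, for `q ≥ 4`). [folklore] -/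
theorem sum_ite_ge_four (hq : 4 ≤ q) (c : R) :
    ∑ i : Fin (q + 1), (if 4 ≤ (i : ℕ) then c else 0) = tq R q * c := by
  rw [Fin.sum_univ_eq_sum_range (fun i => if 4 ≤ i then c else 0) (q + 1), ← Finset.sum_filter]
  have hf : (Finset.range (q + 1)).filter (fun i => 4 ≤ i) = Finset.Ico 4 (q + 1) := by
    ext i; simp [Finset.mem_Ico, and_comm]
  rw [hf, Finset.sum_const, Nat.card_Ico, nsmul_eq_mul, tq]
  congr 1
  rw [show q + 1 - 4 = q - 3 by omega, Nat.cast_sub (by omega)]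
  norm_num

/-! ## Dot products with `e_k`, `w'` -/

/-- `e_k ⬝ v = v_k` (`k ≤ q`). [folklore] -/
theorem eV_dotProduct {k : ℕ} (hk : k < q + 1) (v : Fin (q + 1) → R) :
    eV R q k ⬝ᵥ v = v ⟨k, hk⟩ := by
  simp only [dotProduct, eV, ite_mul, one_mul, zero_mul]
  exact sum_ite_val_eq hk v

/-- `w' ⬝ v = ∑_{i ≥ 4} v_i`. [folklore] -/
theorem wV_dotProduct (v : Fin (q + 1) → R) :
    wV R q ⬝ᵥ v = ∑ i : Fin (q + 1), (if 4 ≤ (i : ℕ) then v i else 0) := by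
  simp only [dotProduct, wV, ite_mul, one_mul, zero_mul]

/-- `∑_{i ≥ 4} (e_m)_i = [4 ≤ m ≤ q]`. [folklore] -/
theorem sum_ge_four_eV (m : ℕ) :
    ∑ i : Fin (q + 1), (if 4 ≤ (i : ℕ) then eV R q m i else 0) = if 4 ≤ m ∧ m < q + 1 then 1 else 0 := by
  simp only [eV]
  have : ∀ i : Fin (q + 1), (if 4 ≤ (i : ℕ) then (if (i : ℕ) = m then (1 : R) else 0) else 0) =
      if (i : ℕ) = m then (if 4 ≤ m then 1 else 0) else 0 := by
    intro i
    by_cases h : (i : ℕ) = m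
    · simp [h]
    · simp [h]
  simp_rw [this]
  by_cases hm : m < q + 1
  · rw [sum_ite_val_eq hm]
    by_cases h4 : 4 ≤ m <;> simp [h4, hm]
  · rw [sum_ite_val_eq_of_lt (by omega)]
    simp [hm]

/-- `∑_{i ≥ 4} w'_i = q - 3`. [folklore] -/
theorem sum_ge_four_wV (hq : 4 ≤ q) :
    ∑ i : Fin (q + 1), (if 4 ≤ (i : ℕ) then wV R q i else 0) = tq R q := by
  have : ∀ i : Fin (q + 1), (if 4 ≤ (i : ℕ) then wV R q i else 0) = if 4 ≤ (i : ℕ) then (1 : R) else 0 := by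
    intro i; by_cases h : 4 ≤ (i : ℕ) <;> simp [wV, h]
  simp_rw [this]
  rw [sum_ite_ge_four hq, mul_one]

/-! ## The action of the slice matrices -/

/-- `(D v)_c = [c ≠ 0] v_c`. [cite: ConnerGesmundoLandsbergVentura2022, eq. (1)] -/
theorem opD_mulVec (v : Fin (q + 1) → R) (c : Fin (q + 1)) :
    (opD R q *ᵥ v) c = if (c : ℕ) = 0 then 0 else v c := by
  simp only [mulVec, dotProduct, opD, ite_mul, one_mul, zero_mul]
  have : ∀ b : Fin (q + 1), (if (b : ℕ) = c ∧ (b : ℕ) ≠ 0 then v b else 0) =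
      if (b : ℕ) = c then (if (c : ℕ) = 0 then 0 else v b) else 0 := by
    intro b
    by_cases h : (b : ℕ) = c
    · by_cases h0 : (c : ℕ) = 0
      · rw [if_neg (fun h' => h'.2 (h.trans h0)), if_pos h, if_pos h0]
      · rw [if_pos ⟨h, fun h' => h0 (h ▸ h')⟩, if_pos h, if_neg h0]
    · rw [if_neg (fun h' => h h'.1), if_neg h]
  simp_rw [this]
  rw [sum_ite_val_eq c.2]

/-- `(G_a v)_c = [c = a] v_0 + [c = 0] v_a` (`1 ≤ a ≤ q`). [cite: ConnerGesmundoLandsbergVentura2022, eq. (1)] -/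
theorem opG_mulVec {a : ℕ} (ha : a ≠ 0) (haq : a < q + 1) (v : Fin (q + 1) → R) (c : Fin (q + 1)) :
    (opG R q a *ᵥ v) c =
      (if (c : ℕ) = a then v ⟨0, by omega⟩ else 0) + (if (c : ℕ) = 0 then v ⟨a, haq⟩ else 0) := by
  simp only [mulVec, dotProduct, opG, ite_mul, one_mul, zero_mul]
  have : ∀ b : Fin (q + 1), (if ((b : ℕ) = 0 ∧ (c : ℕ) = a) ∨ ((c : ℕ) = 0 ∧ (b : ℕ) = a) then v b else 0) =
      (if (b : ℕ) = 0 then (if (c : ℕ) = a then v b else 0) else 0) +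
        (if (b : ℕ) = a then (if (c : ℕ) = 0 then v b else 0) else 0) := by
    intro b
    by_cases hb0 : (b : ℕ) = 0
    · have hba : (b : ℕ) ≠ a := fun h => ha (hb0 ▸ h).symm
      by_cases hca : (c : ℕ) = a
      · rw [if_pos (Or.inl ⟨hb0, hca⟩), if_pos hb0, if_pos hca, if_neg hba, add_zero]
      · rw [if_neg, if_pos hb0, if_neg hca, if_neg hba, add_zero]
        rintro (⟨-, h⟩ | ⟨-, h⟩)
        · exact hca h
        · exact hba h
    · by_cases hba : (b : ℕ) = a
      · by_cases hc0 : (c : ℕ) = 0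
        · rw [if_pos (Or.inr ⟨hc0, hba⟩), if_neg hb0, if_pos hba, if_pos hc0, zero_add]
        · rw [if_neg, if_neg hb0, if_pos hba, if_neg hc0, zero_add]
          rintro (⟨h, -⟩ | ⟨h, -⟩)
          · exact hb0 h
          · exact hc0 h
      · rw [if_neg, if_neg hb0, if_neg hba, add_zero]
        rintro (⟨h, -⟩ | ⟨-, h⟩)
        · exact hb0 h
        · exact hba h
  simp_rw [this, Finset.sum_add_distrib]
  rw [sum_ite_val_eq (by omega : 0 < q + 1), sum_ite_val_eq haq]

/-- `(S v)_c = v_c + v_0` for `c ≠ 0` and `(S v)_0 = ∑_{b ≠ 0} v_b`.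
[cite: ConnerGesmundoLandsbergVentura2022, eq. (1)] -/
theorem opS_mulVec (v : Fin (q + 1) → R) (c : Fin (q + 1)) :
    (opS R q *ᵥ v) c = if (c : ℕ) = 0 then (∑ b, v b) - v ⟨0, by omega⟩ else v c + v ⟨0, by omega⟩ := by
  simp only [mulVec, dotProduct, opS, ite_mul, one_mul, zero_mul]
  by_cases hc0 : (c : ℕ) = 0
  · rw [if_pos hc0]
    have : ∀ b : Fin (q + 1),
        (if ((b : ℕ) = c ∧ (b : ℕ) ≠ 0) ∨ ((b : ℕ) = 0 ∧ (c : ℕ) ≠ 0) ∨ ((c : ℕ) = 0 ∧ (b : ℕ) ≠ 0) then v b else 0) =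
        v b - (if (b : ℕ) = 0 then v b else 0) := by
      intro b
      by_cases hb0 : (b : ℕ) = 0
      · rw [if_neg, if_pos hb0, sub_self]
        rintro (⟨-, h⟩ | ⟨-, h⟩ | ⟨-, h⟩)
        · exact h hb0
        · exact h hc0
        · exact h hb0
      · rw [if_pos (Or.inr (Or.inr ⟨hc0, hb0⟩)), if_neg hb0, sub_zero]
    simp_rw [this]
    rw [Finset.sum_sub_distrib, sum_ite_val_eq (by omega : 0 < q + 1)]
  · rw [if_neg hc0]
    have : ∀ b : Fin (q + 1),
        (if ((b : ℕ) = c ∧ (b : ℕ) ≠ 0) ∨ ((b : ℕ) = 0 ∧ (c : ℕ) ≠ 0) ∨ ((c : ℕ) = 0 ∧ (b : ℕ) ≠ 0) then v b else 0) =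
        (if (b : ℕ) = c then v b else 0) + (if (b : ℕ) = 0 then v b else 0) := by
      intro b
      by_cases hbc : (b : ℕ) = c
      · have hb0 : (b : ℕ) ≠ 0 := fun h => hc0 (hbc ▸ h)
        rw [if_pos (Or.inl ⟨hbc, hb0⟩), if_pos hbc, if_neg hb0, add_zero]
      · by_cases hb0 : (b : ℕ) = 0
        · rw [if_pos (Or.inr (Or.inl ⟨hb0, hc0⟩)), if_neg hbc, if_pos hb0, zero_add]
        · rw [if_neg, if_neg hbc, if_neg hb0, add_zero]
          rintro (⟨h, -⟩ | ⟨h, -⟩ | ⟨h, -⟩)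
          · exact hbc h
          · exact hb0 h
          · exact hc0 h
    simp_rw [this, Finset.sum_add_distrib]
    rw [sum_ite_val_eq c.2, sum_ite_val_eq (by omega : 0 < q + 1)]

/-! ## Rows of `U'` and columns of `U` as vectors -/

/-- The row `γ_k` of `U'` dotted with a vector. [cite: ConnerGesmundoLandsbergVentura2022, §3.5] -/
theorem U'_dotProduct (k : Fin (q + 1)) (v : Fin (q + 1) → R) :
    (fun i => U' R q k i) ⬝ᵥ v =
      if (k : ℕ) ≤ 3 then v k
      else if (k : ℕ) = 4 then ∑ i : Fin (q + 1), (if 4 ≤ (i : ℕ) then v i else 0)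
      else tq R q * v k - ∑ i : Fin (q + 1), (if 4 ≤ (i : ℕ) then v i else 0) := by
  by_cases h3 : (k : ℕ) ≤ 3
  · have : (fun i => U' R q k i) = eV R q k := funext fun i => if_pos h3
    rw [this, if_pos h3, eV_dotProduct k.2]
  by_cases h4 : (k : ℕ) = 4
  · have : (fun i => U' R q k i) = wV R q := funext fun i => by simp only [U', if_neg h3, if_pos h4]
    rw [this, if_neg h3, if_pos h4, wV_dotProduct]
  · have : (fun i => U' R q k i) = tq R q • eV R q k - wV R q :=
      funext fun i => by simp only [U', if_neg h3, if_neg h4, Pi.sub_apply, Pi.smul_apply, smul_eq_mul]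
    rw [this, if_neg h3, if_neg h4, sub_dotProduct, smul_dotProduct, eV_dotProduct k.2, wV_dotProduct,
      smul_eq_mul]

/-- The column `f_l` of `U` as a vector. [cite: ConnerGesmundoLandsbergVentura2022, §3.5] -/
theorem U_col (l : Fin (q + 1)) :
    (fun j => U R q j l) =
      if (l : ℕ) ≤ 3 then eV R q l else if (l : ℕ) = 4 then wV R q else eV R q l - eV R q 4 := by
  funext j
  simp only [U]
  split_ifs <;> rfl

/-- Entries of `U' G U` as `γ_k ⬝ (G f_l)`. [folklore] -/
theorem conj_apply (G : Matrix (Fin (q + 1)) (Fin (q + 1)) R) (k l : Fin (q + 1)) :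
    (U' R q * G * U R q) k l = (fun i => U' R q k i) ⬝ᵥ (G *ᵥ fun j => U R q j l) := by
  rw [Matrix.mul_assoc]
  rfl

/-! ## The images `G f` of the basis vectors -/

/-- `∑_b (e_m)_b = [m ≤ q]`. [folklore] -/
theorem sum_eV (m : ℕ) : ∑ b : Fin (q + 1), eV R q m b = if m < q + 1 then 1 else 0 := by
  simp only [eV]
  by_cases hm : m < q + 1
  · rw [if_pos hm]
    have := sum_ite_val_eq (R := R) hm (fun _ => 1)
    simpa using this
  · rw [if_neg hm]
    have := sum_ite_val_eq_of_lt (R := R) (m := m) (q := q) (by omega) (fun _ => 1)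
    simpa using this

/-- `∑_b w'_b = t`. [folklore] -/
theorem sum_wV (hq : 4 ≤ q) : ∑ b : Fin (q + 1), wV R q b = tq R q := by
  simp only [wV]
  rw [sum_ite_ge_four hq, mul_one]

/-- `D e_m = [m ≠ 0] e_m`. [cite: ConnerGesmundoLandsbergVentura2022, eq. (1)] -/
theorem opD_mulVec_eV (m : ℕ) : opD R q *ᵥ eV R q m = if m = 0 then 0 else eV R q m := by
  funext c
  rw [opD_mulVec]
  by_cases hm : m = 0
  · subst hm
    by_cases hc : (c : ℕ) = 0 <;> simp [eV, hc]
  · rw [if_neg hm]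
    by_cases hc : (c : ℕ) = 0
    · simp [eV, hc, Ne.symm hm]
    · rw [if_neg hc]

/-- `D w' = w'`. [cite: ConnerGesmundoLandsbergVentura2022, eq. (1)] -/
theorem opD_mulVec_wV : opD R q *ᵥ wV R q = wV R q := by
  funext c
  rw [opD_mulVec]
  by_cases hc : (c : ℕ) = 0
  · simp [wV, hc]
  · rw [if_neg hc]

/-- `G_a e_m = [m = 0] e_a + [m = a] e_0` (`1 ≤ a ≤ q`). [cite: ConnerGesmundoLandsbergVentura2022, eq. (1)] -/
theorem opG_mulVec_eV {a : ℕ} (ha : a ≠ 0) (haq : a < q + 1) (m : ℕ) :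
    opG R q a *ᵥ eV R q m = (if m = 0 then eV R q a else 0) + (if m = a then eV R q 0 else 0) := by
  funext c
  rw [opG_mulVec ha haq]
  simp only [Pi.add_apply, ite_apply, Pi.zero_apply, eV]
  congr 1 <;> split_ifs <;> first | rfl | (exfalso; omega)

/-- `G_a w' = 0` (`1 ≤ a ≤ 3`). [cite: ConnerGesmundoLandsbergVentura2022, eq. (1)] -/
theorem opG_mulVec_wV {a : ℕ} (ha : a ≠ 0) (ha3 : a ≤ 3) (hq : 4 ≤ q) : opG R q a *ᵥ wV R q = 0 := by
  funext c
  rw [opG_mulVec ha (by omega)]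
  simp only [Pi.zero_apply, wV]
  rw [if_neg (show ¬ (4 ≤ 0) by omega), if_neg (show ¬ (4 ≤ a) by omega)]
  simp

/-- `S e_0 = ∑_{b ≥ 1} e_b = 1 - e_0`. [cite: ConnerGesmundoLandsbergVentura2022, eq. (1)] -/
theorem opS_mulVec_eV_zero :
    opS R q *ᵥ eV R q 0 = fun c : Fin (q + 1) => if (c : ℕ) = 0 then (0 : R) else 1 := by
  funext c
  rw [opS_mulVec, sum_eV, if_pos (show 0 < q + 1 by omega)]
  by_cases hc : (c : ℕ) = 0 <;> simp [eV, hc]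

/-- `S e_m = e_m + e_0` (`1 ≤ m ≤ q`). [cite: ConnerGesmundoLandsbergVentura2022, eq. (1)] -/
theorem opS_mulVec_eV {m : ℕ} (hm : m ≠ 0) (hmq : m < q + 1) :
    opS R q *ᵥ eV R q m = eV R q m + eV R q 0 := by
  funext c
  rw [opS_mulVec, sum_eV, if_pos hmq]
  simp only [eV, Pi.add_apply]
  split_ifs <;> first | (exfalso; omega) | ring

/-- `S w' = w' + t e_0`. [cite: ConnerGesmundoLandsbergVentura2022, eq. (1)] -/
theorem opS_mulVec_wV (hq : 4 ≤ q) : opS R q *ᵥ wV R q = wV R q + tq R q • eV R q 0 := by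
  funext c
  rw [opS_mulVec, sum_wV hq]
  simp only [eV, wV, Pi.add_apply, Pi.smul_apply, smul_eq_mul]
  split_ifs <;> first | (exfalso; omega) | ring

/-! ## Evaluations at rows of `U'`: coordinates and `∑_{i ≥ 4}` of the images -/

/-- `∑_{i ≥ 4} (e_m - e_4)_i = 0` for `5 ≤ m ≤ q`. [folklore] -/
theorem sum_ge_four_eV_sub {m : ℕ} (hm : 5 ≤ m) (hmq : m < q + 1) :
    ∑ i : Fin (q + 1), (if 4 ≤ (i : ℕ) then (eV R q m - eV R q 4) i else 0) = 0 := by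
  have : ∀ i : Fin (q + 1), (if 4 ≤ (i : ℕ) then (eV R q m - eV R q 4) i else 0) =
      (if 4 ≤ (i : ℕ) then eV R q m i else 0) - (if 4 ≤ (i : ℕ) then eV R q 4 i else 0) := by
    intro i; split_ifs <;> simp
  simp_rw [this]
  rw [Finset.sum_sub_distrib, sum_ge_four_eV, sum_ge_four_eV, if_pos ⟨by omega, hmq⟩,
    if_pos ⟨le_rfl, by omega⟩, sub_self]

/-- `S e_0 = e_1 + e_2 + e_3 + w'` (the same vector as `1 - e_0`, for `q ≥ 3`).
[cite: ConnerGesmundoLandsbergVentura2022, eq. (1)] -/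
theorem opS_mulVec_eV_zero' :
    opS R q *ᵥ eV R q 0 = eV R q 1 + eV R q 2 + eV R q 3 + wV R q := by
  rw [opS_mulVec_eV_zero]
  funext c
  simp only [eV, wV, Pi.add_apply]
  split_ifs <;> first | (exfalso; omega) | ring

/-- `γ_k ⬝ e_m`. [cite: ConnerGesmundoLandsbergVentura2022, §3.5] -/
theorem U'_dotProduct_eV (k : Fin (q + 1)) (m : ℕ) :
    (fun i => U' R q k i) ⬝ᵥ eV R q m =
      if (k : ℕ) ≤ 3 then (if (k : ℕ) = m then 1 else 0)
      else if (k : ℕ) = 4 then (if 4 ≤ m ∧ m < q + 1 then 1 else 0)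
      else tq R q * (if (k : ℕ) = m then 1 else 0) - (if 4 ≤ m ∧ m < q + 1 then 1 else 0) := by
  rw [U'_dotProduct, sum_ge_four_eV]
  rfl

/-- `γ_k ⬝ w' = [k = 4] t`. [cite: ConnerGesmundoLandsbergVentura2022, §3.5] -/
theorem U'_dotProduct_wV (hq : 4 ≤ q) (k : Fin (q + 1)) :
    (fun i => U' R q k i) ⬝ᵥ wV R q = if (k : ℕ) ≤ 3 then 0 else if (k : ℕ) = 4 then tq R q else 0 := by
  rw [U'_dotProduct, sum_ge_four_wV hq]
  simp only [wV]
  split_ifs <;> first | (exfalso; omega) | ring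

/-! ## The conjugated slice matrices -/

/-- **`U' D U = diag(0,1,1,1,t) ⊕ t·1`.** [cite: ConnerGesmundoLandsbergVentura2022, §3.5] -/
theorem conj_opD (hq : 4 ≤ q) : U' R q * opD R q * U R q = bD R q := by
  ext k l
  rw [conj_apply, U_col]
  by_cases hl3 : (l : ℕ) ≤ 3
  · rw [if_pos hl3, opD_mulVec_eV]
    by_cases hl0 : (l : ℕ) = 0
    · rw [if_pos hl0, dotProduct_zero]
      simp only [bD]
      split_ifs <;> first | rfl | (exfalso; omega)
    · rw [if_neg hl0, U'_dotProduct_eV]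
      simp only [bD]
      split_ifs <;> first | (exfalso; omega) | ring
  by_cases hl4 : (l : ℕ) = 4
  · rw [if_neg hl3, if_pos hl4, opD_mulVec_wV, U'_dotProduct_wV hq]
    simp only [bD]
    split_ifs <;> first | (exfalso; omega) | ring
  · rw [if_neg hl3, if_neg hl4, Matrix.mulVec_sub, opD_mulVec_eV, opD_mulVec_eV,
      if_neg (show ¬ ((l : ℕ) = 0) by omega), if_neg (show ¬ ((4 : ℕ) = 0) by omega),
      dotProduct_sub, U'_dotProduct_eV, U'_dotProduct_eV]
    simp only [bD]
    split_ifs <;> first | (exfalso; omega) | ring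

/-- **`U' G_a U = G_a`** for `a = 1, 2, 3`. [cite: ConnerGesmundoLandsbergVentura2022, §3.5] -/
theorem conj_opG {a : ℕ} (ha : a ≠ 0) (ha3 : a ≤ 3) (hq : 4 ≤ q) :
    U' R q * opG R q a * U R q = opG R q a := by
  have haq : a < q + 1 := by omega
  ext k l
  rw [conj_apply, U_col]
  by_cases hl3 : (l : ℕ) ≤ 3
  · rw [if_pos hl3, opG_mulVec_eV ha haq, dotProduct_add]
    by_cases hl0 : (l : ℕ) = 0
    · rw [if_pos hl0, if_neg (show ¬ ((l : ℕ) = a) by omega), dotProduct_zero, add_zero,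
        U'_dotProduct_eV]
      simp only [opG]
      split_ifs <;> first | (exfalso; omega) | ring
    · rw [if_neg hl0, dotProduct_zero, zero_add]
      by_cases hla : (l : ℕ) = a
      · rw [if_pos hla, U'_dotProduct_eV]
        simp only [opG]
        split_ifs <;> first | (exfalso; omega) | ring
      · rw [if_neg hla, dotProduct_zero]
        simp only [opG]
        split_ifs <;> first | (exfalso; omega) | ring
  by_cases hl4 : (l : ℕ) = 4
  · rw [if_neg hl3, if_pos hl4, opG_mulVec_wV ha ha3 hq, dotProduct_zero]
    simp only [opG]
    split_ifs <;> first | (exfalso; omega) | ring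
  · rw [if_neg hl3, if_neg hl4, Matrix.mulVec_sub, opG_mulVec_eV ha haq, opG_mulVec_eV ha haq,
      if_neg (show ¬ ((l : ℕ) = 0) by omega), if_neg (show ¬ ((l : ℕ) = a) by omega),
      if_neg (show ¬ ((4 : ℕ) = 0) by omega), if_neg (show ¬ ((4 : ℕ) = a) by omega),
      add_zero, sub_self, dotProduct_zero]
    simp only [opG]
    split_ifs <;> first | (exfalso; omega) | ring

/-- **`U' S U = [[0,1,1,1,t],[1,1,0,0,0],[1,0,1,0,0],[1,0,0,1,0],[t,0,0,0,t]] ⊕ t·1`.**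
[cite: ConnerGesmundoLandsbergVentura2022, §3.5] -/
theorem conj_opS (hq : 4 ≤ q) : U' R q * opS R q * U R q = bS R q := by
  ext k l
  rw [conj_apply, U_col]
  by_cases hl3 : (l : ℕ) ≤ 3
  · rw [if_pos hl3]
    by_cases hl0 : (l : ℕ) = 0
    · rw [hl0, opS_mulVec_eV_zero', dotProduct_add, dotProduct_add, dotProduct_add,
        U'_dotProduct_eV, U'_dotProduct_eV, U'_dotProduct_eV, U'_dotProduct_wV hq]
      simp only [bS]
      split_ifs <;> first | (exfalso; omega) | ring
    · rw [opS_mulVec_eV hl0 l.2, dotProduct_add, U'_dotProduct_eV, U'_dotProduct_eV]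
      simp only [bS]
      split_ifs <;> first | (exfalso; omega) | ring
  by_cases hl4 : (l : ℕ) = 4
  · rw [if_neg hl3, if_pos hl4, opS_mulVec_wV hq, dotProduct_add, dotProduct_smul, smul_eq_mul,
      U'_dotProduct_eV, U'_dotProduct_wV hq]
    simp only [bS]
    split_ifs <;> first | (exfalso; omega) | ring
  · rw [if_neg hl3, if_neg hl4, Matrix.mulVec_sub, opS_mulVec_eV (show (l : ℕ) ≠ 0 by omega) l.2,
      opS_mulVec_eV (show (4 : ℕ) ≠ 0 by omega) (by omega), dotProduct_sub, dotProduct_add,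
      dotProduct_add, U'_dotProduct_eV, U'_dotProduct_eV, U'_dotProduct_eV]
    simp only [bS]
    split_ifs <;> first | (exfalso; omega) | ring

/-! ## The transformed flattening `K̃ = (1 ⊗ U' ⊗ U') K (1 ⊗ U ⊗ U)` -/

section Ktilde

open scoped Kronecker

variable (R q)

/-- `Ψ_j = (U' ⊗ U') Φ_j (U ⊗ U)`: `Ψ₀ = (D̃ + G₁) ⊗ (D̃ + G₁)`, `Ψ₁ = D̃ ⊗ S̃ + S̃ ⊗ D̃ − D̃ ⊗ D̃`,
`Ψ₂ = D̃ ⊗ G₂ + G₂ ⊗ D̃ + G₂ ⊗ G₁ + G₃ ⊗ G₃` with `D̃ = U'DU`, `S̃ = U'SU` (closed forms `bD`, `bS`).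
[cite: ConnerGesmundoLandsbergVentura2022, §3.5] -/
def PsiJ (j : Fin 3) : Matrix (Fin (q + 1) × Fin (q + 1)) (Fin (q + 1) × Fin (q + 1)) R :=
  if (j : ℕ) = 0 then (bD R q + opG R q 1) ⊗ₖ (bD R q + opG R q 1)
  else if (j : ℕ) = 1 then bD R q ⊗ₖ bS R q + bS R q ⊗ₖ bD R q - bD R q ⊗ₖ bD R q
  else bD R q ⊗ₖ opG R q 2 + opG R q 2 ⊗ₖ bD R q + opG R q 2 ⊗ₖ opG R q 1 + opG R q 3 ⊗ₖ opG R q 3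

/-- The transformed flattening `K̃ = ∑_j Inc_j ⊗ Ψ_j`. [cite: ConnerGesmundoLandsbergVentura2022, §3.5] -/
def Ktil : Matrix (PSub 3 2 × (Fin (q + 1) × Fin (q + 1))) (PSub 3 1 × (Fin (q + 1) × Fin (q + 1))) R :=
  ∑ j : Fin 3, incMat R j ⊗ₖ PsiJ R q j

variable {R q}

/-- `(U' ⊗ U')(A ⊗ B)(U ⊗ U) = (U'AU) ⊗ (U'BU)`. [folklore] -/
theorem conj_kronecker (A B : Matrix (Fin (q + 1)) (Fin (q + 1)) R) :
    U' R q ⊗ₖ U' R q * A ⊗ₖ B * U R q ⊗ₖ U R q = (U' R q * A * U R q) ⊗ₖ (U' R q * B * U R q) := by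
  rw [← mul_kronecker_mul, ← mul_kronecker_mul]

/-- `(U' ⊗ U') Φ_j (U ⊗ U) = Ψ_j`. [cite: ConnerGesmundoLandsbergVentura2022, §3.5] -/
theorem conj_PhiJ (hq : 4 ≤ q) (j : Fin 3) :
    U' R q ⊗ₖ U' R q * PhiJ R q j * U R q ⊗ₖ U R q = PsiJ R q j := by
  have hD := conj_opD (R := R) hq
  have hS := conj_opS (R := R) hq
  have hG1 := conj_opG (R := R) one_ne_zero (by norm_num) hq
  have hG2 := conj_opG (R := R) two_ne_zero (by norm_num) hq
  have hG3 := conj_opG (R := R) three_ne_zero (by norm_num) hq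
  have hDG : U' R q * (opD R q + opG R q 1) * U R q = bD R q + opG R q 1 := by
    rw [Matrix.mul_add, Matrix.add_mul, hD, hG1]
  rcases j with ⟨j, hj⟩
  have : j = 0 ∨ j = 1 ∨ j = 2 := by omega
  rcases this with rfl | rfl | rfl
  · simp only [PhiJ, PsiJ, Phi0, if_true]
    rw [conj_kronecker, hDG]
  · simp only [PhiJ, PsiJ, Phi1, one_ne_zero, if_false, if_true]
    rw [Matrix.mul_sub, Matrix.mul_add, Matrix.sub_mul, Matrix.add_mul, conj_kronecker,
      conj_kronecker, conj_kronecker, hD, hS]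
  · simp only [PhiJ, PsiJ, Phi2, show ¬ ((2 : ℕ) = 0) from by decide,
      show ¬ ((2 : ℕ) = 1) from by decide, if_false]
    rw [Matrix.mul_add, Matrix.mul_add, Matrix.mul_add, Matrix.add_mul, Matrix.add_mul,
      Matrix.add_mul, conj_kronecker, conj_kronecker, conj_kronecker, conj_kronecker, hD, hG1, hG2, hG3]

/-- **The sandwich identity** `(1 ⊗ U' ⊗ U') K_x (1 ⊗ U ⊗ U) = K̃`.
[cite: ConnerGesmundoLandsbergVentura2022, §3.5] -/
theorem sandwich_Kx (hq : 4 ≤ q) :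
    (1 : Matrix (PSub 3 2) (PSub 3 2) R) ⊗ₖ (U' R q ⊗ₖ U' R q) * Kx R q *
        (1 : Matrix (PSub 3 1) (PSub 3 1) R) ⊗ₖ (U R q ⊗ₖ U R q) = Ktil R q := by
  simp only [Kx, Ktil, Matrix.mul_sum, Matrix.sum_mul]
  refine Finset.sum_congr rfl fun j _ => ?_
  rw [← mul_kronecker_mul, ← mul_kronecker_mul, Matrix.one_mul, Matrix.mul_one, conj_PhiJ hq]

end Ktilde

end CGLVThm33

end Literature.Computability.AlgebraicComplexity

end
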